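import Summits.FinalStateConjecture.FinalStateConjecture.Theorems.ModulatedKerrHandoff.Negative.Readback
import Summits.FinalStateConjecture.FinalStateConjecture.Theorems.EIHFluxBalanceInertialRecessionNoHoles
import Summits.FinalStateConjecture.FinalStateConjecture.Theorems.WeakCosmicCensorshipMGHD.Negative.LoadBearing
import Literature.Geometry.Lorentzian.TrivialDataAdmissible
import Literature.Geometry.Lorentzian.MinkowskiCauchyDevelopment
import Literature.Geometry.Lorentzian.MinkowskiGlobalHyperbolicity
import Literature.Geometry.Lorentzian.MGHDUniqueness
import Literature.Geometry.Lorentzian.CauchyProblemProofs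
import Literature.Geometry.Lorentzian.GeodesicIncompleteness

/-!
# `ModulatedKerrHandoff` H′ (crux `stmt-FinalStateConjecture-17402`, route EIHFluxBalance, rank 3) —
# negative-side lemmas IV: the MINKOWSKI MODEL — all sixteen clauses of the modulated ansatz with
# handoff hold, together with complete `𝓘⁺`, in a genuine vacuum development of an admissible datum

Refuter seat `refuter-cdisprove-stmt-FinalStateConjecture-17402-0` (standing disprover of H′, cycle 1,
2026-08-17; workfile `Cruxes/ModulatedKerrHandoff/Disproof.lean` §§7, 12). ANTI-CONTRADICTION
CERTIFICATE of the re-typed crux (cdisprove protocol: the road "the conclusion is internally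
inconsistent, so every admissible datum is exceptional and `not_modulatedKerrHandoff_of_forall_not`
kills H′" is CLOSED), companion of `Negative/Readback.lean` (whose `HandoffN`/`HandoffProp` it
instantiates), in the manner of `UniversalWitnessFamily/Negative/MinkowskiSettled.lean`. `sorry`-free, no
named facts; the only definitions are the model's abbreviations (`𝒟₀ = Minkowski.vacuumCauchyDevelopment`,
the identity lab chart `Φ₀`, the late half-space `L₀`, its self-determined exterior `O₀`).

* §1 the twelve rev-5 clauses at `N = 0` for Minkowski space over `(ℝ³, δ, 0)` — `γ = 1`, `κ = 1/2`,
  `τ₀ = 0`, `U = ⊤`, `Φ = id`, `O₀ = J⁺({t=0}) ∩ I⁻({t>0})`: the identity chart has vanishing deviation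
  from `η` (`deviation_B₀`), the late half-space lies in `O₀` (`L₀_subset_O₀`), exhaustion holds because
  `{x⁰ ≤ t₁} ⊆ J⁻({x⁰ = t₁})` (`ansatz_clauses_minkowski`);
* §2 the four handoff clauses of rev 6 at `N = 0`: (T) lab time is a time function
  (`clauseT_minkowski`, from `Minkowski.causalFuture_singleton`); (O) vacuous (`clauseO_fin0`); (R)
  every normalised future null ray from the slice is a straight null line with unit time component,
  hence stays in `{x⁰ ≥ 0} ⊆ closure O₀` (`raysStayInClosure_O₀`, geodesics of `η` by
  `ModelSpace.isGeodesic_line` + uniqueness `IsGeodesicOn.eqOn_of_velocity_eq_holds`); (QS) vacuous at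
  `N = 0` — the sampled set `{ρ t ≤ ⨅ ∅ = 0}` is eventually empty (`clauseQS_fin0`);
  `handoffN_zero_minkowski : HandoffN 𝒟₀ 0`, `conclusion_minkowski` (complete `𝓘⁺` ∧ the sixteen
  clauses), and `trivialData_handoffProp_of`: the trivial datum HAS `HandoffProp` modulo (i) maximality of
  the Minkowski development, (ii) invariance of the conclusion under isometry of developments — the two
  standard facts (Choquet-Bruhat–Geroch; naturality) separating the tree from deciding the model point.

So no refutation of H′ comes from an inconsistency of its conclusion, and the pointwise road
"every admissible datum on `ℝ³` is exceptional" is closed at the model point modulo (i)–(ii).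

## References

* D. Christodoulou, S. Klainerman, *The global nonlinear stability of the Minkowski space* (1993),
  Thm. 1.0.2 (Minkowski space is the dispersive final state of the trivial datum).
* B. O'Neill, *Semi-Riemannian Geometry* (1983), Ch. 3, Example 25 (geodesics of `ℝⁿᵥ`); Ch. 14, p. 402
  (causality of Minkowski space).
* M. Dafermos, J. Luk, arXiv:1710.01722, Conjecture 1.
-/

set_option linter.dupNamespace false

noncomputable section

namespace Summit.FinalStateConjecture.FinalStateConjecture.Theorems.ModulatedKerrHandoff.Negative.MinkowskiModel

open scoped BigOperators Topology Manifold Classical MeasureTheory Matrix InnerProductSpace ContDiff ENNReal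
open Filter Set Function TopologicalSpace MeasureTheory Literature.Geometry.Lorentzian
open Summit.FinalStateConjecture.FinalStateConjecture.Theorems.WeakCosmicCensorshipMGHD.Negative
  (minkowski_hasCompleteNullInfinity)

/-! ## §1 The Minkowski development of the trivial datum and the twelve rev-5 clauses with `N = 0` -/

section MinkowskiModel

/-- Minkowski spacetime as the vacuum Cauchy development of the trivial data (abbreviation). -/
abbrev 𝒟₀ : VacuumCauchyDevelopment trivialData := Minkowski.vacuumCauchyDevelopment

/-- A point of the Minkowski development read in the global coordinates `E4` (the carrier IS `E4`;
this reducible cast only fixes the syntactic type for instance search). -/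
abbrev toE4 (y : 𝒟₀.carrier) : E4 := y

/-- A point of `E4` as a point of the Minkowski development (inverse reducible cast). -/
abbrev ofE4 (z : E4) : 𝒟₀.carrier := z

/-- The lab chart of the Minkowski model: the identity of `E4` (inclusion of `⊤ : Opens E4`). -/
abbrev Φ₀ : (⊤ : Opens E4) → 𝒟₀.carrier := Subtype.val

/-- The Minkowski reference background on all of `E4`, in the literal form the crux's `let B`
takes for `N = 0` once `∑_{Fin 0} = 0`. -/
abbrev B₀ : ModelBackground := ⟨⊤, fun _ ↦ Minkowski.bilin, fun x ↦ x 0, E4.spatialNorm⟩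

/-- The late half-space `{x⁰ > 0}` as a subset of the Minkowski development. -/
def L₀ : Set 𝒟₀.carrier := Φ₀ '' {x : (⊤ : Opens E4) | (0 : ℝ) < x.1 0}

/-- The self-determined exterior of the Minkowski model: `J⁺({t = 0}) ∩ I⁻({t > 0})`. -/
def O₀ : Set 𝒟₀.carrier := Summit.FinalStateConjecture.exteriorOf 𝒟₀.toCauchyDevelopment L₀

/-- In Minkowski spacetime a point with `0 ≤ y⁰` lies in the causal future of the slice `{t = 0}`. -/
theorem mem_causalFuture_range_embed {y : 𝒟₀.carrier} (hy : 0 ≤ toE4 y 0) :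
    y ∈ 𝒟₀.metric.causalFuture 𝒟₀.timeOrientation (range 𝒟₀.embed) := by
  have hp : ofE4 (E4.ofTimeSpace 0 (E4.spatial (toE4 y))) ∈ range 𝒟₀.embed :=
    ⟨⟨E4.spatial (toE4 y), Minkowski.mem_slice _⟩, rfl⟩
  refine LorentzianMetric.causalFuture_mono (singleton_subset_iff.2 hp) ?_
  have h := Minkowski.causalFuture_singleton (E4.ofTimeSpace 0 (E4.spatial (toE4 y)))
  have h' : toE4 y ∈ LorentzianMetric.causalFuture
      (LorentzianMetric.ofLE (n' := ((⊤ : ℕ∞) : WithTop ℕ∞)) Minkowski.metric le_top)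
      (TimeOrientation.ofLE (n' := ((⊤ : ℕ∞) : WithTop ℕ∞)) Minkowski.timeOrientation le_top)
      {E4.ofTimeSpace 0 (E4.spatial (toE4 y))} := by
    rw [h]
    simp [E4.spatial_ofTimeSpace, hy]
  exact h'

/-- In Minkowski spacetime a point with `y⁰ ≤ t₁` lies in the causal past of any set containing the
slab `{x⁰ = t₁}`. -/
theorem mem_causalPast_of_slab {y : 𝒟₀.carrier} {t₁ : ℝ} (hy : toE4 y 0 ≤ t₁) {T : Set 𝒟₀.carrier}
    (hT : ∀ z : E4, z 0 = t₁ → ofE4 z ∈ T) :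
    y ∈ 𝒟₀.metric.causalPast 𝒟₀.timeOrientation T := by
  have hq : ofE4 (E4.ofTimeSpace t₁ (E4.spatial (toE4 y))) ∈ T := hT _ (by simp)
  refine LorentzianMetric.causalFuture_mono (singleton_subset_iff.2 hq) ?_
  have h := Minkowski.causalPast_singleton (E4.ofTimeSpace t₁ (E4.spatial (toE4 y)))
  have h' : toE4 y ∈ LorentzianMetric.causalPast
      (LorentzianMetric.ofLE (n' := ((⊤ : ℕ∞) : WithTop ℕ∞)) Minkowski.metric le_top)
      (TimeOrientation.ofLE (n' := ((⊤ : ℕ∞) : WithTop ℕ∞)) Minkowski.timeOrientation le_top)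
      {E4.ofTimeSpace t₁ (E4.spatial (toE4 y))} := by
    rw [h]
    simp [E4.spatial_ofTimeSpace, hy]
  exact h'

/-- The late half-space is open (image of an open set under the open embedding `Φ₀`). -/
theorem isOpen_L₀ : IsOpen L₀ := by
  have hopen : IsOpen {x : (⊤ : Opens E4) | (0 : ℝ) < x.1 0} :=
    isOpen_lt continuous_const ((EuclideanSpace.proj (0 : Fin 4)).continuous.comp
      continuous_subtype_val)
  exact (⊤ : Opens E4).2.isOpenEmbedding_subtypeVal.isOpenMap _ hopen

/-- The late half-space lies in its self-determined exterior `O₀ = J⁺({t=0}) ∩ I⁻(L₀)`: in the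
causal future of the slice because `x⁰ > 0`, in `I⁻(L₀)` because an open set lies in its own
chronological past. -/
theorem L₀_subset_O₀ : L₀ ⊆ O₀ := by
  intro y hy
  refine ⟨?_, Summit.FinalStateConjecture.FinalStateConjecture.Theorems.subset_chronologicalPast_of_isOpen
    _ _ isOpen_L₀ hy⟩
  obtain ⟨x, hx, rfl⟩ := hy
  exact mem_causalFuture_range_embed (le_of_lt hx)

/-- The deviation of the identity chart of Minkowski space from `η` vanishes identically
(`dΦ₀ = id`, `mfderiv_subtypeVal`). -/
theorem deviation_B₀ : Minkowski.spacetime.deviation B₀ Φ₀ = 0 := by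
  funext x
  ext v w
  rw [Spacetime.deviation_apply]
  have h := mfderiv_subtypeVal (I' := 𝓡 4) (W := (⊤ : Opens E4)) x
  erw [h]
  show Minkowski.bilin v w - Minkowski.bilin v w = 0
  simp

/-- … hence so does its extension by zero, -/
@[simp] theorem deviationExtend_B₀ : Minkowski.spacetime.deviationExtend B₀ Φ₀ = 0 := by
  funext y
  have h := Spacetime.deviationExtend_coe Minkowski.spacetime B₀ Φ₀ ⟨y, trivial⟩
  exact h.trans (congrFun deviation_B₀ ⟨y, trivial⟩)

/-- … and the `Cᵏ` deviation on every lab slab is `0`. -/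
theorem deviationCk_B₀ (k : ℕ) (t : ℝ) : Minkowski.spacetime.deviationCk B₀ Φ₀ k t = 0 := by
  unfold Spacetime.deviationCk
  rw [deviationExtend_B₀]
  exact supCkENorm_zero _ _

/-- The empty Kerr–Schild sum: for `N = 0` the background bilinear field of the crux is `η`. -/
theorem bilin_add_sum_fin_zero (f : Fin 0 → E4 → E4 →L[ℝ] E4 →L[ℝ] ℝ) :
    (fun x ↦ Minkowski.bilin + ∑ i : Fin 0, f i x) = fun _ ↦ Minkowski.bilin := by
  funext x
  rw [Fin.sum_univ_zero]
  abel

/-- **BOUNDARY LEMMA, core.** Clauses (1)–(12) of the modulated ansatz for the Minkowski development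
with NO hole — `γ = 1`, `κ = 1/2`, `τ₀ = 0`, `U = ⊤`, `Φ = id`, `O = J⁺({t=0}) ∩ I⁻({t>0})` — for any
(empty) families of hole parameters and any background bilinear field `b` equal to `η` (the crux's
`let B` for `N = 0`). -/
theorem ansatz_clauses_minkowski (M a rin : Fin 0 → ℝ) (Λ : Fin 0 → ℝ → lorentzGroup)
    (ξ : Fin 0 → ℝ → E3) (b : E4 → E4 →L[ℝ] E4 →L[ℝ] ℝ) (hb : b = fun _ ↦ Minkowski.bilin) :
    (∀ i, Kerr.IsSubextremal (M i) (a i) ∧ Kerr.rMinus (M i) (a i) < rin i ∧ rin i < Kerr.rPlus (M i) (a i)) ∧ (∀ i t, |((Λ i t : E4 ≃L[ℝ] E4) (E4.basisVector 0)) 0| ≤ (1 : ℝ)) ∧ (∀ i, ContDiff ℝ ((⊤ : ℕ∞) : WithTop ℕ∞) (ξ i) ∧ ContDiff ℝ ((⊤ : ℕ∞) : WithTop ℕ∞) (fun t ↦ ((Λ i t : E4 ≃L[ℝ] E4) : E4 →L[ℝ] E4))) ∧ (∀ i j, i ≠ j → Tendsto (fun t ↦ ‖ξ i t - ξ j t‖)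 atTop atTop) ∧ ((0 : ℝ) < 1 / 2 ∧ (1 / 2 : ℝ) < 1 ∧ ∀ i, ∀ᶠ t in atTop, ‖ξ i t‖ ≤ (1 / 2 : ℝ) ^ 2 * t) ∧ ({x : E4 | (0 : ℝ) < x 0 ∧ ∀ i, rin i < Kerr.radius (a i) (poincareInv (Λ i (x 0)) (E4.ofTimeSpace (x 0) (ξ i (x 0))) x)} ⊆ ((⊤ : Opens E4) : Set E4)) ∧ let B : ModelBackground := ⟨⊤, b, fun x ↦ x 0, E4.spatialNorm⟩; ContMDiff 𝓘(ℝ, E4) (𝓡 4) ((⊤ : ℕ∞) : WithTop ℕ∞) Φ₀ ∧ Topology.IsOpenEmbedding ((B.lateRegion 0).restrict Φ₀) ∧ Φ₀ '' {x : (⊤ : Opens E4) | (0 : ℝ) < x.1 0 ∧ ∀ i, Kerr.rPlus (M i) (a i) < Kerr.radius (a i) (poincareInv (Λ i (x.1 0)) (E4.ofTimeSpace (x.1 0) (ξ i (x.1 0))) x.1)} ⊆ O₀ ∧ Tendsto (fun t ↦ 𝒟₀.toSpacetime.deviationCk B Φ₀ 3 t) atTop (𝓝 0) ∧ Tendsto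 (fun t : ℝ ↦ ⨆ x ∈ {x : (⊤ : Opens E4) | x.1 0 = t ∧ E4.spatialNorm x.1 ≤ 1 / 2 * t}, ⨆ (m : ℕ) (_ : m ≤ 3), ENNReal.ofReal (1 + √(√((⨅ i, ‖E4.spatial x.1 - ξ i t‖) ^ 7))) * ‖iteratedFDeriv ℝ m (𝒟₀.toSpacetime.deviationExtend B Φ₀) x.1‖ₑ) atTop (𝓝 0) ∧ O₀ = Summit.FinalStateConjecture.exteriorOf 𝒟₀.toCauchyDevelopment (Φ₀ '' {x : (⊤ : Opens E4) | (0 : ℝ) < x.1 0 ∧ ∀ i, Kerr.rPlus (M i) (a i) < Kerr.radius (a i) (poincareInv (Λ i (x.1 0)) (E4.ofTimeSpace (x.1 0) (ξ i (x.1 0))) x.1)}) ∧ ∀ t₁ : ℝ, (0 : ℝ) < t₁ → O₀ \ Φ₀ '' {x : (⊤ : Opens E4) | t₁ < x.1 0 ∧ ∀ i, Kerr.rPlus (M i) (a i) < Kerr.radius (a i) (poincareInv (Λ i (x.1 0)) (E4.ofTimeSpace (x.1 0) (ξ i (x.1 0))) x.1)} ⊆ 𝒟₀.metric.causalPast 𝒟₀.timeOrientation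 (Φ₀ '' {x : (⊤ : Opens E4) | x.1 0 = t₁ ∧ ∀ i, Kerr.rPlus (M i) (a i) < Kerr.radius (a i) (poincareInv (Λ i (x.1 0)) (E4.ofTimeSpace (x.1 0) (ξ i (x.1 0))) x.1)}) := by
  subst hb
  refine ⟨fun i ↦ i.elim0, fun i ↦ i.elim0, fun i ↦ i.elim0, fun i ↦ i.elim0,
    ⟨by norm_num, by norm_num, fun i ↦ i.elim0⟩, fun x _ ↦ trivial, ?_⟩
  dsimp only
  refine ⟨?_, ?_, ?_, ?_, ?_, ?_, ?_⟩
  · -- (6) the identity chart is smooth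
    exact contMDiff_subtype_val
  · -- (7) and an open embedding on the late region
    have hopen : IsOpen {x : (⊤ : Opens E4) | (0 : ℝ) < x.1 0} :=
      isOpen_lt continuous_const ((EuclideanSpace.proj (0 : Fin 4)).continuous.comp
        continuous_subtype_val)
    exact (⊤ : Opens E4).2.isOpenEmbedding_subtypeVal.comp hopen.isOpenEmbedding_subtypeVal
  · -- (9) the late half-space lies in `O₀`
    simp only [IsEmpty.forall_iff, and_true]
    exact L₀_subset_O₀
  · -- (10) unweighted deviation: identically `0`
    exact tendsto_const_nhds.congr fun t ↦ (deviationCk_B₀ 3 t).symm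
  · -- (10') weighted deviation inside the cone: identically `0`
    have h0 : (fun t : ℝ ↦ ⨆ x ∈ {x : (⊤ : Opens E4) | x.1 0 = t ∧ E4.spatialNorm x.1 ≤ 1 / 2 * t},
        ⨆ (m : ℕ) (_ : m ≤ 3), ENNReal.ofReal (1 + √(√((⨅ i : Fin 0, ‖E4.spatial x.1 - ξ i t‖) ^ 7))) *
          ‖iteratedFDeriv ℝ m (𝒟₀.toSpacetime.deviationExtend B₀ Φ₀) x.1‖ₑ) = fun _ ↦ 0 := by
      funext t
      simp
    exact (congrArg (fun F : ℝ → ℝ≥0∞ ↦ Tendsto F atTop (𝓝 0)) h0).mpr tendsto_const_nhds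
  · -- (11) `O₀` is the self-determined exterior of the late image
    simp only [IsEmpty.forall_iff, and_true]
    rfl
  · -- (12) exhaustion: `{x⁰ ≤ t₁} ⊆ J⁻({x⁰ = t₁})`
    intro t₁ _ y hy
    have hy' : ¬ t₁ < toE4 y 0 := fun hlt ↦ hy.2 ⟨⟨toE4 y, trivial⟩, ⟨hlt, fun i ↦ i.elim0⟩, rfl⟩
    exact mem_causalPast_of_slab (not_lt.1 hy') fun z hz ↦ ⟨⟨z, trivial⟩, ⟨hz, fun i ↦ i.elim0⟩, rfl⟩

end MinkowskiModel

/-! ## §2 The four handoff clauses in the Minkowski model (`N = 0`): all sixteen clauses are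
jointly satisfiable, with censorship, in a genuine vacuum development of an admissible datum -/

section HandoffMinkowski

/-- **(T) at `N = 0` in Minkowski space** (with `τ₁ = 0`): `J⁺(x) = {y | ‖y̲ − x̲‖ ≤ y⁰ − x⁰}`
(`Minkowski.causalFuture_singleton`), so `x⁰ ≤ y⁰` along causal curves — lab time IS a time function. -/
theorem clauseT_minkowski (rin a : Fin 0 → ℝ) (Λ : Fin 0 → ℝ → lorentzGroup) (ξ : Fin 0 → ℝ → E3) :
    ∃ τ₁ : ℝ, ∀ x y : (⊤ : Opens E4), (τ₁ < x.1 0 ∧ ∀ i, rin i < Kerr.radius (a i) (poincareInv (Λ i (x.1 0)) (E4.ofTimeSpace (x.1 0) (ξ i (x.1 0))) x.1)) → (τ₁ < y.1 0 ∧ ∀ i, rin i < Kerr.radius (a i) (poincareInv (Λ i (y.1 0)) (E4.ofTimeSpace (y.1 0) (ξ i (y.1 0))) y.1)) → Φ₀ y ∈ 𝒟₀.metric.causalFuture 𝒟₀.timeOrientation {Φ₀ x} → x.1 0 ≤ y.1 0 := by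
  refine ⟨0, fun x y _ _ hxy ↦ ?_⟩
  have h := Minkowski.causalFuture_singleton (x : E4)
  have h' : toE4 (Φ₀ y) ∈ LorentzianMetric.causalFuture
      (LorentzianMetric.ofLE (n' := ((⊤ : ℕ∞) : WithTop ℕ∞)) Minkowski.metric le_top)
      (TimeOrientation.ofLE (n' := ((⊤ : ℕ∞) : WithTop ℕ∞)) Minkowski.timeOrientation le_top)
      {(x : E4)} := hxy
  rw [h] at h'
  have h'' : ‖E4.spatial (y : E4) - E4.spatial (x : E4)‖ ≤ (y : E4) 0 - (x : E4) 0 := by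
    simpa using h'
  linarith [norm_nonneg (E4.spatial (y : E4) - E4.spatial (x : E4))]

/-- **(O) at `N = 0`**: vacuous. -/
theorem clauseO_fin0 (Λ : Fin 0 → ℝ → lorentzGroup) :
    ∀ (i : Fin 0) (t : ℝ), 0 < (((Λ i t : lorentzGroup) : E4 ≃L[ℝ] E4) (E4.basisVector 0)) 0 :=
  fun i ↦ i.elim0

-- operator-norm instance paths on form-valued maps are slow to unify (clause (QS))
set_option synthInstance.maxHeartbeats 400000 in
/-- **(QS) at `N = 0`**: with NO centre the distance to the nearest centre is the junk `⨅ ∅ = 0`, so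
the constraint `ρ t ≤ 0` empties the sampled set as soon as `ρ t > 0` — eventually, since `ρ → ∞` —
and the weighted supremum is `⊥ = 0` from then on (the painted background is anyway the constant `η`).
So (QS) is vacuous at `N = 0`, exactly like (O). -/
theorem clauseQS_fin0 (M a : Fin 0 → ℝ) (Λ : Fin 0 → ℝ → lorentzGroup) (ξ : Fin 0 → ℝ → E3) (κ : ℝ) :
    ∀ ρ : ℝ → ℝ, Tendsto ρ atTop atTop → Tendsto (fun t : ℝ ↦ ⨆ x ∈ {x : E4 | x 0 = t ∧ E4.spatialNorm x ≤ κ * t ∧ ρ t ≤ ⨅ i, ‖E4.spatial x - ξ i t‖}, ENNReal.ofReal (1 + √(√((⨅ i, ‖E4.spatial x - ξ i t‖) ^ 7))) * ‖fderiv ℝ (fun y : E4 ↦ Minkowski.bilin + ∑ i, (boostedKerrBilin (Λ i (y 0)) (E4.ofTimeSpace (y 0) (ξ i (y 0))) (M i) (a i) y - Minkowski.bilin)) x (E4.basisVector 0)‖ₑ) atTop (𝓝 0) := by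
  intro ρ hρ
  refine tendsto_const_nhds.congr' ?_
  filter_upwards [hρ.eventually_gt_atTop 0] with t ht
  symm
  simp only [ENNReal.iSup_eq_zero]
  intro x hx
  exfalso
  have h3 := hx.2.2
  rw [Real.iInf_of_isEmpty] at h3
  linarith

/-- Points of `E4` with nonnegative time lie in the closure of the late half-space `L₀ = {x⁰ > 0}`
(approach `z` by `z + s e₀`, `s ↓ 0`). -/
theorem mem_closure_L₀ {z : E4} (hz : 0 ≤ z 0) : ofE4 z ∈ closure L₀ := by
  have hc : Continuous fun s : ℝ ↦ z + s • E4.basisVector 0 := by fun_prop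
  have hlim : Tendsto (fun s : ℝ ↦ z + s • E4.basisVector 0) (𝓝[>] 0) (𝓝 z) := by
    have h := hc.continuousAt (x := (0 : ℝ)) |>.tendsto
    simp only [zero_smul, add_zero] at h
    exact h.mono_left nhdsWithin_le_nhds
  refine mem_closure_of_tendsto (f := fun s : ℝ ↦ ofE4 (z + s • E4.basisVector 0))
    (b := 𝓝[>] (0 : ℝ)) hlim ?_
  filter_upwards [self_mem_nhdsWithin] with s hs
  refine ⟨⟨z + s • E4.basisVector 0, trivial⟩, ?_, rfl⟩
  show (0 : ℝ) < (z + s • E4.basisVector 0) 0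
  have : (z + s • E4.basisVector 0) 0 = z 0 + s := by simp [E4.basisVector]
  rw [this]
  exact add_pos_of_nonneg_of_pos hz hs

/-- **(R) at `N = 0` in Minkowski space: every normalised future null ray from the slice stays in
`closure O₀`.** A normalised null ray is a maximal geodesic of `η`; geodesics of `η` are straight lines
defined on `ℝ` (`ModelSpace.isGeodesic_line`, uniqueness `IsGeodesicOn.eqOn_of_velocity_eq_holds`), so
`γ(t) = ι p + t v` with `v⁰ = 1` by the normalisation `η(v, ∂ₜ) = −1`; hence `(γ t)⁰ = t ≥ 0`, and
`{x⁰ ≥ 0} ⊆ closure L₀ ⊆ closure O₀` (`L₀_subset_O₀`, `mem_closure_L₀`). -/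
theorem raysStayInClosure_O₀ :
    Summit.FinalStateConjecture.RaysStayInClosure 𝒟₀.toCauchyDevelopment O₀ := by
  intro hLC p γ dom hray _hunb t ht ht0
  haveI : Minkowski.smoothMetric.toPseudoRiemannianMetric.HasLeviCivita := hLC
  haveI : CovariantDerivative.ContMDiffCovariantDerivative
      𝒟₀.metric.toPseudoRiemannianMetric.leviCivita 1 :=
    ⟨𝒟₀.metric.toPseudoRiemannianMetric.isLocallyContMDiff_leviCivita_holds
      1 (by rw [show ((1 : ℕ∞) : ℕ∞ω) + 1 = 2 by norm_num]; exact WithTop.coe_le_coe.2 le_top)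
      univ isOpen_univ⟩
  obtain ⟨hmax, h0, hγ0, -, -, hnorm⟩ := hray
  set x₀ : E4 := toE4 (γ 0) with hx₀
  set v : E4 := (velocity (𝓡 4) γ 0 : E4) with hv
  -- the straight line with the same initial data is a geodesic on `ℝ`
  have hline : IsGeodesic 𝒟₀.metric.toPseudoRiemannianMetric.leviCivita
      (fun s : ℝ ↦ ofE4 (x₀ + s • v)) :=
    ModelSpace.isGeodesic_line (g := Minkowski.smoothMetric.toPseudoRiemannianMetric)
      (G₀ := Minkowski.bilin) Minkowski.smoothMetric_val x₀ v
  have hl0 : γ 0 = (fun s : ℝ ↦ ofE4 (x₀ + s • v)) 0 := by simp [hx₀]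
  have hlv : velocity (𝓡 4) γ 0 = velocity (𝓡 4) (fun s : ℝ ↦ ofE4 (x₀ + s • v)) 0 := by
    rw [show velocity (𝓡 4) (fun s : ℝ ↦ ofE4 (x₀ + s • v)) 0 = v from ModelSpace.velocity_line x₀ v 0]
  have heq : EqOn γ (fun s : ℝ ↦ ofE4 (x₀ + s • v)) dom :=
    IsGeodesicOn.eqOn_of_velocity_eq_holds hmax.isOpen hmax.2.1 hmax.isGeodesicOn
      ((hline.isGeodesicOn univ).mono (subset_univ _)) h0 hl0 hlv
  -- normalisation: `v⁰ = 1`; base point on the slice: `x₀⁰ = 0`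
  have hv0 : v 0 = 1 := by
    have h1 : Minkowski.bilin v (E4.basisVector 0) = -1 := by
      have h2 := hnorm
      rw [Minkowski.vacuumCauchyDevelopment_normal, Minkowski.sliceNormal_apply] at h2
      exact h2
    rw [Minkowski.bilin_symm, Minkowski.bilin_basisVector_zero_left] at h1
    linarith
  have hx00 : x₀ 0 = 0 := by
    rw [hx₀, hγ0, Minkowski.vacuumCauchyDevelopment_embed, Minkowski.sliceEmbed_apply]
    simp
  have hγt : toE4 (γ t) 0 = t := by
    rw [heq ht]
    show (x₀ + t • v) 0 = t
    simp [hx00, hv0]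
  exact closure_mono L₀_subset_O₀ (mem_closure_L₀ (z := toE4 (γ t)) (by rw [hγt]; exact ht0))

-- operator-norm instance paths on form-valued maps are slow to unify (clause (QS))
set_option synthInstance.maxHeartbeats 400000 in
/-- **BOUNDARY LEMMA (rev 6), core.** All SIXTEEN clauses of the modulated ansatz with handoff for the
Minkowski development with NO hole — `γ = 1`, `κ = 1/2`, `τ₀ = 0`, `U = ⊤`, `Φ = id`,
`O = J⁺({t=0}) ∩ I⁻({t>0})` — for any (empty) families of hole parameters and any background bilinear
field `b` equal to `η` (the crux's `let B` for `N = 0`): the twelve of `ansatz_clauses_minkowski` plus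
(T) `clauseT_minkowski`, (O) vacuous, (R) `raysStayInClosure_O₀`, (QS) `clauseQS_fin0`. -/
theorem handoff_clauses_minkowski (M a rin : Fin 0 → ℝ) (Λ : Fin 0 → ℝ → lorentzGroup)
    (ξ : Fin 0 → ℝ → E3) (b : E4 → E4 →L[ℝ] E4 →L[ℝ] ℝ) (hb : b = fun _ ↦ Minkowski.bilin) :
    (∀ i, Kerr.IsSubextremal (M i) (a i) ∧ Kerr.rMinus (M i) (a i) < rin i ∧ rin i < Kerr.rPlus (M i) (a i)) ∧ (∀ i t, |((Λ i t : E4 ≃L[ℝ] E4) (E4.basisVector 0)) 0| ≤ (1 : ℝ)) ∧ (∀ i, ContDiff ℝ ((⊤ : ℕ∞) : WithTop ℕ∞) (ξ i) ∧ ContDiff ℝ ((⊤ : ℕ∞) : WithTop ℕ∞) (fun t ↦ ((Λ i t : E4 ≃L[ℝ] E4) : E4 →L[ℝ] E4))) ∧ (∀ i j, i ≠ j → Tendsto (fun t ↦ ‖ξ i t - ξ j t‖) atTop atTop) ∧ ((0 : ℝ) < 1 / 2 ∧ (1 / 2 : ℝ) < 1 ∧ ∀ i, ∀ᶠ t in atTop,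 ‖ξ i t‖ ≤ (1 / 2 : ℝ) ^ 2 * t) ∧ ({x : E4 | (0 : ℝ) < x 0 ∧ ∀ i, rin i < Kerr.radius (a i) (poincareInv (Λ i (x 0)) (E4.ofTimeSpace (x 0) (ξ i (x 0))) x)} ⊆ ((⊤ : Opens E4) : Set E4)) ∧ let B : ModelBackground := ⟨⊤, b, fun x ↦ x 0, E4.spatialNorm⟩; ContMDiff 𝓘(ℝ, E4) (𝓡 4) ((⊤ : ℕ∞) : WithTop ℕ∞) Φ₀ ∧ Topology.IsOpenEmbedding ((B.lateRegion 0).restrict Φ₀) ∧ Φ₀ '' {x : (⊤ : Opens E4) | (0 : ℝ) < x.1 0 ∧ ∀ i, Kerr.rPlus (M i) (a i) < Kerr.radius (a i) (poincareInv (Λ i (x.1 0)) (E4.ofTimeSpace (x.1 0) (ξ i (x.1 0))) x.1)} ⊆ O₀ ∧ Tendsto (fun t ↦ 𝒟₀.toSpacetime.deviationCk B Φ₀ 3 t) atTop (𝓝 0) ∧ Tendsto (fun t : ℝ ↦ ⨆ x ∈ {x : (⊤ : Opens E4) | x.1 0 = t ∧ E4.spatialNorm x.1 ≤ 1 / 2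 * t}, ⨆ (m : ℕ) (_ : m ≤ 3), ENNReal.ofReal (1 + √(√((⨅ i, ‖E4.spatial x.1 - ξ i t‖) ^ 7))) * ‖iteratedFDeriv ℝ m (𝒟₀.toSpacetime.deviationExtend B Φ₀) x.1‖ₑ) atTop (𝓝 0) ∧ O₀ = Summit.FinalStateConjecture.exteriorOf 𝒟₀.toCauchyDevelopment (Φ₀ '' {x : (⊤ : Opens E4) | (0 : ℝ) < x.1 0 ∧ ∀ i, Kerr.rPlus (M i) (a i) < Kerr.radius (a i) (poincareInv (Λ i (x.1 0)) (E4.ofTimeSpace (x.1 0) (ξ i (x.1 0))) x.1)}) ∧ (∀ t₁ : ℝ, (0 : ℝ) < t₁ → O₀ \ Φ₀ '' {x : (⊤ : Opens E4) | t₁ < x.1 0 ∧ ∀ i, Kerr.rPlus (M i) (a i) < Kerr.radius (a i) (poincareInv (Λ i (x.1 0)) (E4.ofTimeSpace (x.1 0) (ξ i (x.1 0))) x.1)} ⊆ 𝒟₀.metric.causalPast 𝒟₀.timeOrientation (Φ₀ '' {x : (⊤ : Opens E4) | x.1 0 = t₁ ∧ ∀ i, Kerr.rPlus (M i) (a i)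 < Kerr.radius (a i) (poincareInv (Λ i (x.1 0)) (E4.ofTimeSpace (x.1 0) (ξ i (x.1 0))) x.1)})) ∧ (∃ τ₁ : ℝ, ∀ x y : (⊤ : Opens E4), (τ₁ < x.1 0 ∧ ∀ i, rin i < Kerr.radius (a i) (poincareInv (Λ i (x.1 0)) (E4.ofTimeSpace (x.1 0) (ξ i (x.1 0))) x.1)) → (τ₁ < y.1 0 ∧ ∀ i, rin i < Kerr.radius (a i) (poincareInv (Λ i (y.1 0)) (E4.ofTimeSpace (y.1 0) (ξ i (y.1 0))) y.1)) → Φ₀ y ∈ 𝒟₀.metric.causalFuture 𝒟₀.timeOrientation {Φ₀ x} → x.1 0 ≤ y.1 0) ∧ (∀ (i : Fin 0) (t : ℝ), 0 < (((Λ i t : lorentzGroup) : E4 ≃L[ℝ] E4) (E4.basisVector 0)) 0) ∧ Summit.FinalStateConjecture.RaysStayInClosure 𝒟₀.toCauchyDevelopment O₀ ∧ (∀ ρ : ℝ → ℝ, Tendsto ρ atTop atTop → Tendsto (fun t : ℝ ↦ ⨆ x ∈ {x : E4 | x 0 = t ∧ E4.spatialNorm x ≤ 1 / 2 * t ∧ ρ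 t ≤ ⨅ i, ‖E4.spatial x - ξ i t‖}, ENNReal.ofReal (1 + √(√((⨅ i, ‖E4.spatial x - ξ i t‖) ^ 7))) * ‖fderiv ℝ (fun y : E4 ↦ Minkowski.bilin + ∑ i, (boostedKerrBilin (Λ i (y 0)) (E4.ofTimeSpace (y 0) (ξ i (y 0))) (M i) (a i) y - Minkowski.bilin)) x (E4.basisVector 0)‖ₑ) atTop (𝓝 0)) := by
  obtain ⟨h1, h2, h3, h4, h5, h6, hB⟩ := ansatz_clauses_minkowski M a rin Λ ξ b hb
  refine ⟨h1, h2, h3, h4, h5, h6, ?_⟩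
  obtain ⟨h7, h8, h9, h10, h10', h11, h12⟩ := hB
  exact ⟨h7, h8, h9, h10, h10', h11, h12, clauseT_minkowski rin a Λ ξ, clauseO_fin0 Λ,
    raysStayInClosure_O₀, clauseQS_fin0 M a Λ ξ (1 / 2)⟩

/-- **BOUNDARY LEMMA (rev 6) — Minkowski space satisfies the modulated ansatz WITH HANDOFF, `N = 0`**
(the literal `∃`-block of H′, `HandoffN … 0`, for `Minkowski.vacuumCauchyDevelopment`). -/
theorem handoffN_zero_minkowski : HandoffN 𝒟₀ 0 :=
  ⟨Fin.elim0, Fin.elim0, Fin.elim0, Fin.elim0, Fin.elim0, 1, 1 / 2, 0, ⊤, Φ₀, O₀,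
    handoff_clauses_minkowski _ _ _ _ _ _ (bilin_add_sum_fin_zero _)⟩

/-- The ansatz-with-handoff clause of H′ holds for the Minkowski development (with `N = 0`).
[cite: ChristodoulouKlainerman1993, Thm. 1.0.2] -/
theorem handoff_minkowski : ∃ N, HandoffN 𝒟₀ N := ⟨0, handoffN_zero_minkowski⟩

/-- **The per-development CONCLUSION of H′ — complete `𝓘⁺` (sojourn form) AND the sixteen-clause
modulated ansatz with handoff — holds for a genuine vacuum Cauchy development of an admissible datum**:
Minkowski space over `(ℝ³, δ, 0)`. ANTI-VACUITY / ANTI-CONTRADICTION CERTIFICATE for the re-typed crux: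
no refutation can come from an internal inconsistency of the conclusion (which, the admissible class of
`ℝ³` being nonempty, would have killed H′ outright by `not_modulatedKerrHandoff_of_forall_not`, `Negative/Readback.lean`).
[cite: ChristodoulouKlainerman1993, Thm. 1.0.2] -/
theorem conclusion_minkowski :
    _root_.Summit.FinalStateConjecture.HasCompleteNullInfinity 𝒟₀.toCauchyDevelopment ∧ ∃ N, HandoffN 𝒟₀ N :=
  ⟨minkowski_hasCompleteNullInfinity, handoff_minkowski⟩

/-- NEAR-MISS MADE PRECISE (rev 6): the trivial datum HAS `HandoffProp` — hence the pointwise road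
"every admissible datum on `ℝ³` is exceptional" to a kill of H′ is CLOSED — modulo (i) MAXIMALITY of the
Minkowski development among vacuum Cauchy developments of `(ℝ³, δ, 0)` and (ii) invariance of the
conclusion under isometry of developments (for the sixteen clauses other than (R) and complete `𝓘⁺`
this invariance is PROVED, §14). -/
theorem trivialData_handoffProp_of (hmax : 𝒟₀.IsMaximal)
    (hinv : ∀ 𝒟 : VacuumCauchyDevelopment trivialData, 𝒟₀.IsIsometricTo 𝒟.toCauchyDevelopment →
      (_root_.Summit.FinalStateConjecture.HasCompleteNullInfinity 𝒟₀.toCauchyDevelopment ∧ ∃ N, HandoffN 𝒟₀ N) →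
        (_root_.Summit.FinalStateConjecture.HasCompleteNullInfinity 𝒟.toCauchyDevelopment ∧ ∃ N, HandoffN 𝒟 N)) :
    HandoffProp Minkowski.slice trivialData :=
  ⟨⟨𝒟₀, hmax⟩, fun 𝒟 h𝒟 ↦ hinv 𝒟 (mghd_unique_cauchy 𝒟₀ 𝒟 hmax h𝒟) conclusion_minkowski⟩

end HandoffMinkowski

end Summit.FinalStateConjecture.FinalStateConjecture.Theorems.ModulatedKerrHandoff.Negative.MinkowskiModel

end
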